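import Summits.CriticalPhenomena.PercolationContinuityZ3.Theorems.PercNearOneGluingNoHeavyLowerTailSahiThreeCopyCellX6dMasks1
import Summits.CriticalPhenomena.PercolationContinuityZ3.Theorems.PercNearOneGluingNoHeavyLowerTailSahiThreeCopyHitPairsSix

/-!
# `NoHeavyLowerTail` (crux stmt-CriticalPhenomena-4575), Sahi programme: ★★★ **`LawGood 6 π 1_{X6d}` AT EVERY FRONT PROFILE**

Support file (Sahi cell, seat `prim-sahi-p1`, generation 65; `--supports stmt-CriticalPhenomena-4575`).  Assembly: the interior table (masks `prof6 m`,
`…CellX6dMasks*`) and the boundary (up-set sections on five coordinates, `frontGood_six_of_boundary`).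
COMPUTATIONAL content inherited (cell checks, section identities). [this work]
-/

namespace Summit.CriticalPhenomena.PercolationContinuityZ3.Theorems.SahiThreeCopy

open Finset Function Literature.Combinatorics.Sahi2008
open scoped BigOperators

/-- ★★ `LawGood 6 (prof6 m) 1_{X6d}` for EVERY interior front profile (all 64 masks). [this work] -/
theorem lawGood_X6d_prof (m : Fin 64) : LawGood 6 (prof6 m) (setInd X6dSet) := by
  fin_cases m
  · exact lawGood_X6d111111
  · exact lawGood_X6dm1
  · exact lawGood_X6dm2
  · exact lawGood_X6dm3
  · exact lawGood_X6dm4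
  · exact lawGood_X6dm5
  · exact lawGood_X6dm6
  · exact lawGood_X6dm7
  · exact lawGood_X6d111211
  · exact lawGood_X6dm9
  · exact lawGood_X6d121211
  · exact lawGood_X6dm11
  · exact lawGood_X6d112211
  · exact lawGood_X6dm13
  · exact lawGood_X6d122211
  · exact lawGood_X6d222211
  · exact lawGood_X6dm16
  · exact lawGood_X6dm17
  · exact lawGood_X6dm18
  · exact lawGood_X6dm19
  · exact lawGood_X6dm20
  · exact lawGood_X6dm21
  · exact lawGood_X6dm22
  · exact lawGood_X6dm23
  · exact lawGood_X6dm24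
  · exact lawGood_X6dm25
  · exact lawGood_X6dm26
  · exact lawGood_X6dm27
  · exact lawGood_X6dm28
  · exact lawGood_X6dm29
  · exact lawGood_X6dm30
  · exact lawGood_X6dm31
  · exact lawGood_X6d111112
  · exact lawGood_X6dm33
  · exact lawGood_X6dm34
  · exact lawGood_X6dm35
  · exact lawGood_X6dm36
  · exact lawGood_X6dm37
  · exact lawGood_X6dm38
  · exact lawGood_X6dm39
  · exact lawGood_X6d111212
  · exact lawGood_X6dm41
  · exact lawGood_X6d121212
  · exact lawGood_X6dm43
  · exact lawGood_X6d112212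
  · exact lawGood_X6dm45
  · exact lawGood_X6d122212
  · exact lawGood_X6d222212
  · exact lawGood_X6d111122
  · exact lawGood_X6dm49
  · exact lawGood_X6dm50
  · exact lawGood_X6dm51
  · exact lawGood_X6dm52
  · exact lawGood_X6dm53
  · exact lawGood_X6dm54
  · exact lawGood_X6dm55
  · exact lawGood_X6d111222
  · exact lawGood_X6dm57
  · exact lawGood_X6d121222
  · exact lawGood_X6dm59
  · exact lawGood_X6d112222
  · exact lawGood_X6dm61
  · exact lawGood_X6d122222
  · exact lawGood_X6d222222

/-- ★★★ **`LawGood 6 π 1_{X6d}` at EVERY front profile** (interior: the table; boundary: sections are up-sets on five coordinates). [this work] -/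
theorem lawGood_X6d_all (π : Fin 6 → ℕ) : LawGood 6 π (setInd X6dSet) :=
  lawGood_all_of_interior_of_boundary (k := 6) (f := setInd X6dSet)
    (fun m hm => lawGood_X6d_prof ⟨m, hm⟩)
    (fun π i hi => lawGood_of_frontGood (frontGood_six_of_boundary π i hi isUpperSet_X6dSet)) π

end Summit.CriticalPhenomena.PercolationContinuityZ3.Theorems.SahiThreeCopy
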